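import Summits.QuantumAdvantage.QuantumAdvantage.Theorems.CubicForrelationNearExactIsExactCubicFormLightStructure
import Summits.QuantumAdvantage.QuantumAdvantage.Theorems.CubicForrelationNearExactIsExactCubicFormCellL2Mu2

/-!
# Crux `CubicForrelation.NearExactIsExact` (stmt-QuantumAdvantage-14043) — LIGHT STRUCTURE for `t̄ = s₀ ∧ ω₄` (`μ = 2`):
  `G|_{H×H} = ε·ω₄ ⊕ D` with `D = 0`, or `rank D = 2` (`wt < 192`, family `B₂`), and `D` supported on `P × P` when `wt < 160` (family `R`)

Certificate seat `b2b-cforr-cert` (gen 41).  HONEST FRAMING: kernel-checked assembly (standard axioms), the `μ = 2` analogue of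
`tls_light_structure` (…CubicFormLightStructure, `h ≥ 3`): for a cubic `κ` on `3 + (1 + 8)` bits whose cell `v₀` is the light cell in
coordinates (`t̄ = s₀ ∧ ω₄`, one half vanishing) and whose neighbouring cell `v₀ ⊕ e_t` has weight `< 192` (resp. `< 160`), the
`H × H` block of the third derivative `ι_{e_t}` at unit vectors is `ε·ω₄ ⊕ D` where `D` is one of the half-forms of the neighbour
(…CubicFormCellL2Mu2 `tl2_cell_eight_mu2`): symmetric, additive, and `D = 0` or `D = p ∧ q`; under `wt < 160` moreover `D` vanishes on
every vector supported off `P = {lo i, hi i}` (…CubicFormOmega4R).  This is the input format `Γ = ε′ω₄ + m∧m′ + s₀∧γ` /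
"`D ∈ R ⊂ Λ²P*`" of the leaves `tpa_R2_w4a/b` (HOME/b2b-cforr-cert-g39/E1280-HANDPROOFS.md §1.5–1.6), up to the Bool→tensor dictionary.
Nothing about `θ₁₂`; NOT summit progress.

* `tls_light_structure_mu2`.

References: E1280-HANDPROOFS.md §1.5–1.6; R2-PARTNER.md §3 (L2, μ = 2).  Axioms: the standard three.
-/

set_option linter.dupNamespace false -- D-0017: single-problem summit ⇒ `QuantumAdvantage.QuantumAdvantage` by design

namespace Summit.QuantumAdvantage.QuantumAdvantage.Theorems.CubicForrelation.NearExactIsExact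

open Finset
open Literature.Computability.QuantumComplexity
open Literature.Computability.QuantumComplexity.BuzetChailloux (bxor zeroVec bxor_comm bxor_self bxor_zeroVec zeroVec_bxor
  bxor_bxor_cancel_left)

/-- **Light structure, `μ = 2`.**  See the module docstring. [this work; E1280-HANDPROOFS §1.5–1.6] -/
theorem tls_light_structure_mu2 (κ : (Fin (3 + (1 + 8)) → Bool) → Bool) (hκ : IsDegLeFun 3 κ) (v₀ : Fin 3 → Bool)
    (lo hi : Fin 2 → Fin 8)
    (hlo : Function.Injective lo) (hhi : Function.Injective hi) (hlohi : ∀ i j, lo i ≠ hi j)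
    (ω' : (Fin 8 → Bool) → (Fin 8 → Bool) → Bool)
    (hω' : ∀ v w, ω' v w = decide ((∑ i : Fin 2, ((if v (lo i) = true then (1 : ZMod 2) else 0) * (if w (hi i) = true then (1 : ZMod 2) else 0) +
        (if v (hi i) = true then (1 : ZMod 2) else 0) * (if w (lo i) = true then (1 : ZMod 2) else 0))) = 1))
    (hT : ∀ u v w x : Fin (1 + 8) → Bool,
      ((((fun s => κ (Fin.append v₀ s)) x ^^ (fun s => κ (Fin.append v₀ s)) (bxor x w)) ^^
          ((fun s => κ (Fin.append v₀ s)) (bxor x v) ^^ (fun s => κ (Fin.append v₀ s)) (bxor (bxor x v) w))) ^^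
        (((fun s => κ (Fin.append v₀ s)) (bxor x u) ^^ (fun s => κ (Fin.append v₀ s)) (bxor (bxor x u) w)) ^^
          ((fun s => κ (Fin.append v₀ s)) (bxor (bxor x u) v) ^^ (fun s => κ (Fin.append v₀ s)) (bxor (bxor (bxor x u) v) w)))) =
        (((u (Fin.castAdd 8 (0 : Fin 1)) && ω' (fun j => v (Fin.natAdd 1 j)) (fun j => w (Fin.natAdd 1 j))) ^^
            (v (Fin.castAdd 8 (0 : Fin 1)) && ω' (fun j => u (Fin.natAdd 1 j)) (fun j => w (Fin.natAdd 1 j)))) ^^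
          (w (Fin.castAdd 8 (0 : Fin 1)) && ω' (fun j => u (Fin.natAdd 1 j)) (fun j => v (Fin.natAdd 1 j)))))
    (b : Bool) (hhalf : ∀ s : Fin 8 → Bool, κ (Fin.append v₀ (Fin.append ![!b] s)) = false)
    (t : Fin 3) :
    (#(univ.filter fun y : Fin (1 + 8) → Bool => κ (Fin.append (bxor v₀ (fun l => decide (l = t))) y) = true) < 192 →
      ∃ (ε : Bool) (D : (Fin 8 → Bool) → (Fin 8 → Bool) → Bool),
        (∀ σ τ : Fin 8,
        (((κ (Fin.append v₀ zeroVec) ^^ κ (bxor (Fin.append v₀ zeroVec) (fun l => decide (l = Fin.natAdd 3 (Fin.natAdd 1 τ))))) ^^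
          (κ (bxor (Fin.append v₀ zeroVec) (fun l => decide (l = Fin.natAdd 3 (Fin.natAdd 1 σ)))) ^^
            κ (bxor (bxor (Fin.append v₀ zeroVec) (fun l => decide (l = Fin.natAdd 3 (Fin.natAdd 1 σ))))
              (fun l => decide (l = Fin.natAdd 3 (Fin.natAdd 1 τ)))))) ^^
        ((κ (bxor (Fin.append v₀ zeroVec) (fun l => decide (l = Fin.castAdd (1 + 8) t))) ^^
            κ (bxor (bxor (Fin.append v₀ zeroVec) (fun l => decide (l = Fin.castAdd (1 + 8) t)))
              (fun l => decide (l = Fin.natAdd 3 (Fin.natAdd 1 τ))))) ^^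
          (κ (bxor (bxor (Fin.append v₀ zeroVec) (fun l => decide (l = Fin.castAdd (1 + 8) t)))
              (fun l => decide (l = Fin.natAdd 3 (Fin.natAdd 1 σ)))) ^^
            κ (bxor (bxor (bxor (Fin.append v₀ zeroVec) (fun l => decide (l = Fin.castAdd (1 + 8) t)))
              (fun l => decide (l = Fin.natAdd 3 (Fin.natAdd 1 σ)))) (fun l => decide (l = Fin.natAdd 3 (Fin.natAdd 1 τ))))))) =
        ((ε && ω' (fun l => decide (l = σ)) (fun l => decide (l = τ))) ^^ D (fun l => decide (l = σ)) (fun l => decide (l = τ)))) ∧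
        (∀ x y, D x y = D y x) ∧ (∀ x y z, D (bxor x y) z = (D x z ^^ D y z)) ∧
        ((∀ x y, D x y = false) ∨ (∃ p q : Fin 8 → Bool, ∀ x y, D x y = ((D x q && D y p) ^^ (D x p && D y q))))) ∧
    (#(univ.filter fun y : Fin (1 + 8) → Bool => κ (Fin.append (bxor v₀ (fun l => decide (l = t))) y) = true) < 160 →
      ∃ (ε : Bool) (D : (Fin 8 → Bool) → (Fin 8 → Bool) → Bool),
        (∀ σ τ : Fin 8,
        (((κ (Fin.append v₀ zeroVec) ^^ κ (bxor (Fin.append v₀ zeroVec) (fun l => decide (l = Fin.natAdd 3 (Fin.natAdd 1 τ))))) ^^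
          (κ (bxor (Fin.append v₀ zeroVec) (fun l => decide (l = Fin.natAdd 3 (Fin.natAdd 1 σ)))) ^^
            κ (bxor (bxor (Fin.append v₀ zeroVec) (fun l => decide (l = Fin.natAdd 3 (Fin.natAdd 1 σ))))
              (fun l => decide (l = Fin.natAdd 3 (Fin.natAdd 1 τ)))))) ^^
        ((κ (bxor (Fin.append v₀ zeroVec) (fun l => decide (l = Fin.castAdd (1 + 8) t))) ^^
            κ (bxor (bxor (Fin.append v₀ zeroVec) (fun l => decide (l = Fin.castAdd (1 + 8) t)))
              (fun l => decide (l = Fin.natAdd 3 (Fin.natAdd 1 τ))))) ^^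
          (κ (bxor (bxor (Fin.append v₀ zeroVec) (fun l => decide (l = Fin.castAdd (1 + 8) t)))
              (fun l => decide (l = Fin.natAdd 3 (Fin.natAdd 1 σ)))) ^^
            κ (bxor (bxor (bxor (Fin.append v₀ zeroVec) (fun l => decide (l = Fin.castAdd (1 + 8) t)))
              (fun l => decide (l = Fin.natAdd 3 (Fin.natAdd 1 σ)))) (fun l => decide (l = Fin.natAdd 3 (Fin.natAdd 1 τ))))))) =
        ((ε && ω' (fun l => decide (l = σ)) (fun l => decide (l = τ))) ^^ D (fun l => decide (l = σ)) (fun l => decide (l = τ)))) ∧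
        (∀ x y, D x y = D y x) ∧ (∀ x y z, D (bxor x y) z = (D x z ^^ D y z)) ∧
        ((∀ x y, D x y = false) ∨ ((∃ p q : Fin 8 → Bool, ∀ x y, D x y = ((D x q && D y p) ^^ (D x p && D y q))) ∧
          (∀ x, (∀ i, x (lo i) = false) → (∀ i, x (hi i) = false) → ∀ y, D x y = false)))) := by
  classical
  -- the neighbouring cell has the same cubic form
  set v₁ : Fin 3 → Bool := bxor v₀ (fun l => decide (l = t)) with hv₁
  have hT₁ : ∀ u v w x : Fin (1 + 8) → Bool,
      ((((fun s => κ (Fin.append v₁ s)) x ^^ (fun s => κ (Fin.append v₁ s)) (bxor x w)) ^^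
          ((fun s => κ (Fin.append v₁ s)) (bxor x v) ^^ (fun s => κ (Fin.append v₁ s)) (bxor (bxor x v) w))) ^^
        (((fun s => κ (Fin.append v₁ s)) (bxor x u) ^^ (fun s => κ (Fin.append v₁ s)) (bxor (bxor x u) w)) ^^
          ((fun s => κ (Fin.append v₁ s)) (bxor (bxor x u) v) ^^ (fun s => κ (Fin.append v₁ s)) (bxor (bxor (bxor x u) v) w)))) =
        (((u (Fin.castAdd 8 (0 : Fin 1)) && ω' (fun j => v (Fin.natAdd 1 j)) (fun j => w (Fin.natAdd 1 j))) ^^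
            (v (Fin.castAdd 8 (0 : Fin 1)) && ω' (fun j => u (Fin.natAdd 1 j)) (fun j => w (Fin.natAdd 1 j)))) ^^
          (w (Fin.castAdd 8 (0 : Fin 1)) && ω' (fun j => u (Fin.natAdd 1 j)) (fun j => v (Fin.natAdd 1 j)))) := by
    intro u v w x
    rw [← hT u v w x]
    exact tls_cells_third κ hκ v₁ v₀ u v w x x
  -- the half-forms of the neighbour, as local definitions
  set D₀ : (Fin 8 → Bool) → (Fin 8 → Bool) → Bool := fun v w => ((κ (Fin.append v₁ (Fin.append ![false] zeroVec)) ^^ κ (Fin.append v₁ (Fin.append ![false] (bxor zeroVec w)))) ^^ (κ (Fin.append v₁ (Fin.append ![false] (bxor zeroVec v))) ^^ κ (Fin.append v₁ (Fin.append ![false] (bxor (bxor zeroVec v) w))))) with hD₀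
  set D₁ : (Fin 8 → Bool) → (Fin 8 → Bool) → Bool := fun v w => ((κ (Fin.append v₁ (Fin.append ![true] zeroVec)) ^^ κ (Fin.append v₁ (Fin.append ![true] (bxor zeroVec w)))) ^^ (κ (Fin.append v₁ (Fin.append ![true] (bxor zeroVec v))) ^^ κ (Fin.append v₁ (Fin.append ![true] (bxor (bxor zeroVec v) w))))) with hD₁
  have M : (∀ v w x, ((κ (Fin.append v₁ (Fin.append ![false] x)) ^^ κ (Fin.append v₁ (Fin.append ![false] (bxor x w)))) ^^ (κ (Fin.append v₁ (Fin.append ![false] (bxor x v))) ^^ κ (Fin.append v₁ (Fin.append ![false] (bxor (bxor x v) w))))) = D₀ v w) ∧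
      (∀ v w x, ((κ (Fin.append v₁ (Fin.append ![true] x)) ^^ κ (Fin.append v₁ (Fin.append ![true] (bxor x w)))) ^^ (κ (Fin.append v₁ (Fin.append ![true] (bxor x v))) ^^ κ (Fin.append v₁ (Fin.append ![true] (bxor (bxor x v) w))))) = D₁ v w) ∧
      (∀ v w, (D₀ v w ^^ D₁ v w) = ω' v w) ∧
      (#(univ.filter fun y : Fin (1 + 8) → Bool => κ (Fin.append v₁ y) = true) < 160 → (∀ x y, D₀ x y = false) ∨ (∀ x y, D₁ x y = false) ∨
        ((∃ p q : Fin 8 → Bool, ∀ x y, D₀ x y = ((D₀ x q && D₀ y p) ^^ (D₀ x p && D₀ y q))) ∧ (∃ p q : Fin 8 → Bool, ∀ x y, D₁ x y = ((D₁ x q && D₁ y p) ^^ (D₁ x p && D₁ y q))) ∧ (∀ x, (∀ i, x (lo i) = false) → (∀ i, x (hi i) = false) → ∀ y, D₀ x y = false ∧ D₁ x y = false))) ∧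
      (#(univ.filter fun y : Fin (1 + 8) → Bool => κ (Fin.append v₁ y) = true) < 192 → (∀ x y, D₀ x y = false) ∨ (∀ x y, D₁ x y = false) ∨ (∃ p q : Fin 8 → Bool, ∀ x y, D₀ x y = ((D₀ x q && D₀ y p) ^^ (D₀ x p && D₀ y q))) ∨ (∃ p q : Fin 8 → Bool, ∀ x y, D₁ x y = ((D₁ x q && D₁ y p) ^^ (D₁ x p && D₁ y q)))) :=
    tl2_cell_eight_mu2 (fun s => κ (Fin.append v₁ s)) lo hi hlo hhi hlohi ω' hω' hT₁
  obtain ⟨hB₀', hB₁', hω, h160, h192⟩ := M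
  obtain ⟨hs₀, ha₀, -, -⟩ := tcb_form_basic (fun s => κ (Fin.append v₁ (Fin.append ![false] s))) D₀ hB₀'
  obtain ⟨hs₁, ha₁, -, -⟩ := tcb_form_basic (fun s => κ (Fin.append v₁ (Fin.append ![true] s))) D₁ hB₁'
  -- the light cell: one half vanishes, so its `0`-half form is `ε₀ · ω'`
  obtain ⟨h3₀, hforms₀⟩ := tl2_cell_halves (fun s => κ (Fin.append v₀ s)) ω' hT
  simp only at hforms₀
  have key₀ : ∃ ε₀ : Bool, ∀ σ τ : Fin 8,
      ((κ (Fin.append v₀ (Fin.append ![false] zeroVec)) ^^ κ (Fin.append v₀ (Fin.append ![false] (bxor zeroVec (fun l => decide (l = τ)))))) ^^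
        (κ (Fin.append v₀ (Fin.append ![false] (bxor zeroVec (fun l => decide (l = σ))))) ^^
          κ (Fin.append v₀ (Fin.append ![false] (bxor (bxor zeroVec (fun l => decide (l = σ))) (fun l => decide (l = τ))))))) =
      (ε₀ && ω' (fun l => decide (l = σ)) (fun l => decide (l = τ))) := by
    cases b
    · refine ⟨true, fun σ τ => ?_⟩
      have e := hforms₀ (fun l => decide (l = σ)) (fun l => decide (l = τ)) zeroVec zeroVec
      simp only [Bool.not_false] at hhalf
      simp only [hhalf, Bool.xor_false] at e
      rw [Bool.true_and]; exact e
    · refine ⟨false, fun σ τ => ?_⟩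
      simp only [Bool.not_true] at hhalf
      simp only [hhalf, Bool.false_and, Bool.xor_false]
  obtain ⟨ε₀, hε₀⟩ := key₀
  -- the `H × H` block: neighbour's `0`-half form plus the light cell's
  have F₀ : ∀ σ τ : Fin 8,
      (((κ (Fin.append v₀ zeroVec) ^^ κ (bxor (Fin.append v₀ zeroVec) (fun l => decide (l = Fin.natAdd 3 (Fin.natAdd 1 τ))))) ^^
          (κ (bxor (Fin.append v₀ zeroVec) (fun l => decide (l = Fin.natAdd 3 (Fin.natAdd 1 σ)))) ^^
            κ (bxor (bxor (Fin.append v₀ zeroVec) (fun l => decide (l = Fin.natAdd 3 (Fin.natAdd 1 σ))))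
              (fun l => decide (l = Fin.natAdd 3 (Fin.natAdd 1 τ)))))) ^^
        ((κ (bxor (Fin.append v₀ zeroVec) (fun l => decide (l = Fin.castAdd (1 + 8) t))) ^^
            κ (bxor (bxor (Fin.append v₀ zeroVec) (fun l => decide (l = Fin.castAdd (1 + 8) t)))
              (fun l => decide (l = Fin.natAdd 3 (Fin.natAdd 1 τ))))) ^^
          (κ (bxor (bxor (Fin.append v₀ zeroVec) (fun l => decide (l = Fin.castAdd (1 + 8) t)))
              (fun l => decide (l = Fin.natAdd 3 (Fin.natAdd 1 σ)))) ^^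
            κ (bxor (bxor (bxor (Fin.append v₀ zeroVec) (fun l => decide (l = Fin.castAdd (1 + 8) t)))
              (fun l => decide (l = Fin.natAdd 3 (Fin.natAdd 1 σ)))) (fun l => decide (l = Fin.natAdd 3 (Fin.natAdd 1 τ))))))) =
      ((ε₀ && ω' (fun l => decide (l = σ)) (fun l => decide (l = τ))) ^^ D₀ (fun l => decide (l = σ)) (fun l => decide (l = τ))) := by
    intro σ τ
    have e := tcm_mixed_third κ v₀ t σ τ
    simp only at e
    rw [e, ← hv₁, hε₀ σ τ]
    exact Bool.xor_comm _ _
  have F₁ : ∀ σ τ : Fin 8,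
      (((κ (Fin.append v₀ zeroVec) ^^ κ (bxor (Fin.append v₀ zeroVec) (fun l => decide (l = Fin.natAdd 3 (Fin.natAdd 1 τ))))) ^^
          (κ (bxor (Fin.append v₀ zeroVec) (fun l => decide (l = Fin.natAdd 3 (Fin.natAdd 1 σ)))) ^^
            κ (bxor (bxor (Fin.append v₀ zeroVec) (fun l => decide (l = Fin.natAdd 3 (Fin.natAdd 1 σ))))
              (fun l => decide (l = Fin.natAdd 3 (Fin.natAdd 1 τ)))))) ^^
        ((κ (bxor (Fin.append v₀ zeroVec) (fun l => decide (l = Fin.castAdd (1 + 8) t))) ^^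
            κ (bxor (bxor (Fin.append v₀ zeroVec) (fun l => decide (l = Fin.castAdd (1 + 8) t)))
              (fun l => decide (l = Fin.natAdd 3 (Fin.natAdd 1 τ))))) ^^
          (κ (bxor (bxor (Fin.append v₀ zeroVec) (fun l => decide (l = Fin.castAdd (1 + 8) t)))
              (fun l => decide (l = Fin.natAdd 3 (Fin.natAdd 1 σ)))) ^^
            κ (bxor (bxor (bxor (Fin.append v₀ zeroVec) (fun l => decide (l = Fin.castAdd (1 + 8) t)))
              (fun l => decide (l = Fin.natAdd 3 (Fin.natAdd 1 σ)))) (fun l => decide (l = Fin.natAdd 3 (Fin.natAdd 1 τ))))))) =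
      ((!ε₀ && ω' (fun l => decide (l = σ)) (fun l => decide (l = τ))) ^^ D₁ (fun l => decide (l = σ)) (fun l => decide (l = τ))) := by
    intro σ τ
    rw [F₀ σ τ]
    have e := hω (fun l => decide (l = σ)) (fun l => decide (l = τ))
    revert e
    cases ε₀ <;> cases ω' (fun l => decide (l = σ)) (fun l => decide (l = τ)) <;>
      cases D₀ (fun l => decide (l = σ)) (fun l => decide (l = τ)) <;> cases D₁ (fun l => decide (l = σ)) (fun l => decide (l = τ)) <;> decide
  have hD₀ω : (∀ x y, D₁ x y = false) → ∀ x y, D₀ x y = ω' x y := fun hz x y => by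
    rw [← hω x y, hz]; cases D₀ x y <;> rfl
  refine ⟨fun hwt => ?_, fun hwt => ?_⟩
  · rcases h192 hwt with hz | hz | hp | hp
    · exact ⟨ε₀, D₀, F₀, hs₀, ha₀, Or.inl hz⟩
    · exact ⟨!ε₀, D₁, F₁, hs₁, ha₁, Or.inl hz⟩
    · exact ⟨ε₀, D₀, F₀, hs₀, ha₀, Or.inr hp⟩
    · exact ⟨!ε₀, D₁, F₁, hs₁, ha₁, Or.inr hp⟩
  · rcases h160 hwt with hz | hz | ⟨hp, -, hsupp⟩
    · exact ⟨ε₀, D₀, F₀, hs₀, ha₀, Or.inl hz⟩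
    · exact ⟨!ε₀, D₁, F₁, hs₁, ha₁, Or.inl hz⟩
    · exact ⟨ε₀, D₀, F₀, hs₀, ha₀, Or.inr ⟨hp, fun x hl hh y => (hsupp x hl hh y).1⟩⟩

end Summit.QuantumAdvantage.QuantumAdvantage.Theorems.CubicForrelation.NearExactIsExact
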